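import Literature.NumberTheory.LFunctions.Zhang2022.Section12Top1522Profiles
import Literature.NumberTheory.LFunctions.Zhang2022.Section12Eq1216EdgeExact

/-!
# Zhang (2022) §12 p. 73, `Z22:§12.u049` second line in the EXACT reading: the top-range `n`-sum of
# `S_j(𝐚₁₅,𝐚₂₂)` passes to the printed `z`-integral — `main12u049sumEx = main12u049intEx + o(α)`, PROVED OUTRIGHT

Topic `Literature/NumberTheory/LFunctions/Zhang2022` (Landau–Siegel audit tree; verdict-neutral).
Y. Zhang, *Discrete mean estimates and the Landau–Siegel zero*, arXiv:2211.02515v1 (2022)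
[Zhang2022LandauSiegel], §12 p. 73 (tex L3694–L3702): "By lemma 8.2, 8.3 and 12.3, the sum over `P″₁ < dr < P₂` is
equal to `(L′²ι₃/((0.504)(0.498)log²P))Σ_{P^{0.496}<n<P^{0.498}}|χ(n)|λ₀ⱼ(n)φ(n)⁻¹𝓖_{j6}(P^{0.498}/n)𝓦*_j(n) + (L′²ι₄/
((0.504)(0.5)log²P))Σ_{P^{0.496}<n<P^{0.5}}(…)𝓖_{j7}(P^{0.5}/n)𝓦*_j(n) + o(α) = (𝔞ι₃/((0.504)(0.498)log P))∫_{0.496}^{0.498}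
𝔤𝔥_{j6}(0.498−z)𝓦*_j(P^z)dz + (𝔞ι₄/((0.504)(0.5)log P))∫_{0.496}^{0.5}𝔤𝔥_{j7}(0.5−z)𝓦*_j(P^z)dz + o(α)`" — **an unrefereed
manuscript under adjudication; this file proves the SECOND EQUALITY of that display (sum → integral) in the exact-weight
reading of record (`𝓦*_j = frakwStarEx`, ruling R-18) from tree theorems and asserts nothing about its Theorems 1–2.**

`main12u049sumEx_sub_intEx : ∀ ε > 0, ForAllLarge, ∀ j ∈ {1,2,3}, ‖main12u049sumEx − main12u049intEx‖ ≤ εα` — no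
manuscript claim enters as a hypothesis. It is the Int half of the RT-02 node `Typed.Sec12C.Top1522Ex` (whose other
half, `S_j|_{P″₁<dr<P₂} = main12u049sumEx + o(α)`, is zl-w12-p9's). Route = the §10 template `Section10cTop1422Int`
(seat sz-d34/zl-w10-p5) on two windows: (i) the window sum `winSum(P^{0.496}, P^θ]` IS `lamAvg` from `⌊P^{0.496}⌋ + 1`
(`winSum_eq_lamAvg_floor`, exact; the exponential form of `𝓦*ˣ` at naturals, `frakwStarEx_eq_exp`); (ii) the §8 evaluation
rule `Typed.Sec10C.lamAvg_rule` with the profile `G_μ(t) = 𝓖_{jμ}(P^θ/t)𝓦*ˣ_j(t)` (`topG1522_bounds`: `M = 146(1+7π)`,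
`M′log P = π(449(1+7π) + 146(3(1+7π)+7))`); (iii) the boundary piece `∫_{P^{0.496}}^{⌊P^{0.496}⌋+1} G/t` (`≤ M`); (iv)
`t = P^z` (`integral_Ppow_Ppow`); (v) `𝓖_{jμ}(P^{θ−z}) = 𝔤𝔥_{jμ}(θ − z) + O_{c′}(𝓛⁻⁸)` (sz-d19, `frakgW_six/seven_at_rpow`),
the exact weight being KEPT at level `D` as the node prescribes; (vi) `c_D·L′(1,χ)² = 𝔞`. Total `≪_{c′} 𝓛⁻¹² ≤ εα`.

## References

* Y. Zhang, arXiv:2211.02515v1 (2022), §12 p. 73 (u049); §8 pp. 48–49; §2 (2.10), (2.13), (2.22), (2.31).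
  [cite: Zhang2022LandauSiegel, §12 (12.16) p.73]
-/

noncomputable section

open Complex Real ComplexConjugate
open Literature.NumberTheory.LFunctions.Zhang2022
open Literature.NumberTheory.LFunctions.Zhang2022.Skeleton
open Literature.NumberTheory.LFunctions.Zhang2022.Typed.Sec10C (lamAvg lamAvg_rule forAllLarge_five_c
  frakA_eq_cD_mul bigP_rpow_eq_Ppow one_le_bigP norm_iota34_le)

namespace Literature.NumberTheory.LFunctions.Zhang2022.Typed.Sec12C

section Top1522Int

variable (c' : ℝ) {D : ℕ} [NeZero D] (χ : DirichletCharacter ℂ D)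

omit [NeZero D] in
/-- **The window sum of §12 IS a `lamAvg` of §10c**: for `lo ≥ 0`, `Σ_{1≤n<⌈hi⌉, lo<n} = Σ_{⌊lo⌋+1 ≤ n < ⌈hi⌉}` (exact).
[cite: Zhang2022LandauSiegel, §8 (8.10) p.47] -/
theorem winSum_eq_lamAvg_floor (j : ℕ) {lo : ℝ} (hlo : 0 ≤ lo) (hi : ℝ) (w : ℕ → ℂ) :
    winSum c' χ j lo hi w = lamAvg c' χ j ((⌊lo⌋₊ + 1 : ℕ) : ℝ) hi w := by
  unfold winSum lamAvg
  rw [Nat.ceil_natCast]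
  refine Finset.sum_congr ?_ fun _ _ => rfl
  ext n
  simp only [Finset.mem_filter, Finset.mem_Ico]
  constructor
  · rintro ⟨⟨-, h2⟩, h3⟩
    exact ⟨Nat.succ_le_of_lt ((Nat.floor_lt hlo).mpr h3), h2⟩
  · rintro ⟨h1, h2⟩
    have h3 : ⌊lo⌋₊ < n := by omega
    exact ⟨⟨by omega, h2⟩, (Nat.floor_lt hlo).mp h3⟩

omit [NeZero D] in
/-- The window parameters for `𝓛 ≥ 6`: with `lo = P^{0.496}`, `lo' = ⌊lo⌋ + 1`, `hi = P^θ` (`0.498 ≤ θ ≤ 0.5`):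
`1 ≤ lo`, `lo < lo' ≤ lo + 1`, `lo' ≤ hi`, `hi + 1 ≤ P`. [cite: Zhang2022LandauSiegel, §2 (2.6)] -/
theorem window_params (hℓ6 : 6 ≤ ell D) {θ : ℝ} (hθ0 : 0.498 ≤ θ) (hθ1 : θ ≤ 0.5) :
    1 ≤ bigP D ^ (0.496 : ℝ) ∧
      bigP D ^ (0.496 : ℝ) < ((⌊bigP D ^ (0.496 : ℝ)⌋₊ + 1 : ℕ) : ℝ) ∧
      ((⌊bigP D ^ (0.496 : ℝ)⌋₊ + 1 : ℕ) : ℝ) ≤ bigP D ^ (0.496 : ℝ) + 1 ∧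
      ((⌊bigP D ^ (0.496 : ℝ)⌋₊ + 1 : ℕ) : ℝ) ≤ bigP D ^ θ ∧
      bigP D ^ θ + 1 ≤ bigP D := by
  have hP0 : 0 < bigP D := bigP_pos D
  have hP1 : 1 ≤ bigP D := one_le_bigP D
  have hlo1 : 1 ≤ bigP D ^ (0.496 : ℝ) := Real.one_le_rpow hP1 (by norm_num)
  have hlt : bigP D ^ (0.496 : ℝ) < ((⌊bigP D ^ (0.496 : ℝ)⌋₊ + 1 : ℕ) : ℝ) := by
    push_cast; exact Nat.lt_floor_add_one _
  have hle : ((⌊bigP D ^ (0.496 : ℝ)⌋₊ + 1 : ℕ) : ℝ) ≤ bigP D ^ (0.496 : ℝ) + 1 := by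
    push_cast; linarith [Nat.floor_le (by linarith : (0 : ℝ) ≤ bigP D ^ (0.496 : ℝ))]
  -- `P^{0.002} ≥ 2` (indeed `e^{0.002·6⁹}`), so `P^{0.498} ≥ 2P^{0.496} ≥ P^{0.496} + 1`, and `P ≥ 2P^{0.5} ≥ P^θ + 1`
  have hΛ : Real.log (bigP D) = ell D ^ 9 := by rw [bigP, Real.log_exp]
  have hΛ6 : (6 : ℝ) ^ 9 ≤ Real.log (bigP D) := by rw [hΛ]; exact pow_le_pow_left₀ (by norm_num) hℓ6 9
  have htwo : ∀ a : ℝ, 0.002 ≤ a → 2 ≤ bigP D ^ a := by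
    intro a ha
    have h1 : Real.exp 1 ≤ bigP D ^ a := by
      rw [Real.rpow_def_of_pos hP0, Real.exp_le_exp]
      nlinarith
    have h2 : (2 : ℝ) ≤ Real.exp 1 := by have := Real.exp_one_gt_d9; linarith
    linarith
  have h498 : bigP D ^ (0.496 : ℝ) + 1 ≤ bigP D ^ θ := by
    have e : bigP D ^ (0.496 : ℝ) * bigP D ^ (θ - 0.496) = bigP D ^ θ := by
      rw [← Real.rpow_add hP0]; norm_num
    have h2 := htwo (θ - 0.496) (by linarith)
    calc bigP D ^ (0.496 : ℝ) + 1 ≤ bigP D ^ (0.496 : ℝ) * 2 := by linarith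
      _ ≤ bigP D ^ (0.496 : ℝ) * bigP D ^ (θ - 0.496) := by gcongr
      _ = bigP D ^ θ := e
  have hhiP : bigP D ^ θ + 1 ≤ bigP D := by
    have e : bigP D ^ θ * bigP D ^ (1 - θ) = bigP D := by
      rw [← Real.rpow_add hP0]; norm_num
    have h2 := htwo (1 - θ) (by linarith)
    have hθ1' : 1 ≤ bigP D ^ θ := Real.one_le_rpow hP1 (by linarith)
    calc bigP D ^ θ + 1 ≤ bigP D ^ θ * 2 := by linarith
      _ ≤ bigP D ^ θ * bigP D ^ (1 - θ) := by gcongr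
      _ = bigP D := e
  exact ⟨hlo1, hlt, hle, hle.trans h498, hhiP⟩

omit [NeZero D] in
/-- Arithmetic of the final `o(α)` bound (as in `Section10cTop1422Int`). [folklore] -/
private theorem arith_final {ℓ ε A C₀ Mtot B nK nS : ℝ} (hℓ : 1 ≤ ℓ) (hε : 0 < ε) (hA : 0 ≤ A) (hC₀ : 0 ≤ C₀)
    (hMtot : 0 ≤ Mtot) (hB : 0 ≤ B) (hnS0 : 0 ≤ nS)
    (hnK : nK ≤ A * ℓ ^ 4 / ℓ ^ 18) (hnS : nS ≤ C₀ * ℓ ^ 2 * Mtot + B * ℓ)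
    (hbig : A * (C₀ * Mtot + B) / (ε * π) + 1 ≤ ℓ) :
    nK * nS ≤ ε * (π / ℓ ^ 9) := by
  have hℓ0 : 0 < ℓ := by linarith
  set Ctot : ℝ := A * (C₀ * Mtot + B) with hCtot
  have hCtot0 : 0 ≤ Ctot := by positivity
  have hS' : nS ≤ (C₀ * Mtot + B) * ℓ ^ 2 := by
    have : ℓ ≤ ℓ ^ 2 := by nlinarith
    nlinarith
  have h1 : nK * nS ≤ Ctot * (ℓ ^ 4 * ℓ ^ 2 / ℓ ^ 18) := by
    calc nK * nS ≤ (A * ℓ ^ 4 / ℓ ^ 18) * ((C₀ * Mtot + B) * ℓ ^ 2) :=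
          mul_le_mul hnK hS' hnS0 (by positivity)
      _ = Ctot * (ℓ ^ 4 * ℓ ^ 2 / ℓ ^ 18) := by rw [hCtot]; ring
  have h2 : Ctot * (ℓ ^ 4 * ℓ ^ 2 / ℓ ^ 18) = Ctot / ℓ ^ 3 / ℓ ^ 9 := by
    field_simp
  have hεπ : 0 < ε * π := by positivity
  have h3 : Ctot ≤ ε * π * ℓ ^ 3 := by
    have h4 : Ctot / (ε * π) ≤ ℓ := by linarith
    rw [div_le_iff₀ hεπ] at h4
    have h5 : ℓ ≤ ℓ ^ 3 := by nlinarith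
    nlinarith
  rw [h2] at h1
  refine h1.trans ?_
  rw [div_div, div_le_iff₀ (by positivity)]
  calc Ctot ≤ ε * π * ℓ ^ 3 := h3
    _ = ε * (π / ℓ ^ 9) * (ℓ ^ 3 * ℓ ^ 9) := by field_simp

/-- The prefactors of `main12u049sumEx`: `‖L′(1,χ)²ι/((0.504)θ log²P)‖ ≤ 150e⁹𝓛⁴/𝓛¹⁸` for `‖ι‖ ≤ 2.3`, `θ ≥ 0.498`
(`|L′(1,χ)| ≤ 4e^{9/2}𝓛²`, `log P = 𝓛⁹`). [cite: Zhang2022LandauSiegel, §12 (12.16) p.73] -/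
theorem norm_K1522_le (hℓ3 : 3 ≤ ell D) (hp : χ.IsPrimitive) {ι : ℂ} (hι : ‖ι‖ ≤ 2.3) {θ : ℝ}
    (hθ0 : 0.498 ≤ θ) :
    ‖deriv χ.LFunction 1 ^ 2 * ι / (0.504 * θ * Real.log (bigP D) ^ 2)‖ ≤
      150 * Real.exp 9 * ell D ^ 4 / ell D ^ 18 := by
  have hΛ : Real.log (bigP D) = ell D ^ 9 := by rw [bigP, Real.log_exp]
  have hℓ0 : 0 < ell D := by linarith
  have hL : ‖deriv χ.LFunction 1‖ ≤ 4 * Real.exp (9 / 2) * ell D ^ 2 := by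
    have hlog : 3 ≤ Real.log D := by simpa only [ell] using hℓ3
    have hw : ‖(1 : ℂ) - 1‖ ≤ 1 / Real.log D := by
      rw [sub_self, norm_zero]; exact div_nonneg zero_le_one (by linarith)
    have h := Lemma31.norm_deriv_LFunction_le_near_one χ hlog hp hw
    have h1 : (1 + ell D) * ell D ≤ 2 * ell D ^ 2 := by nlinarith
    calc ‖deriv χ.LFunction 1‖ ≤ 2 * Real.exp (9 / 2) * (1 + ell D) * ell D := h
      _ = 2 * Real.exp (9 / 2) * ((1 + ell D) * ell D) := by ring
      _ ≤ 2 * Real.exp (9 / 2) * (2 * ell D ^ 2) := by gcongr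
      _ = 4 * Real.exp (9 / 2) * ell D ^ 2 := by ring
  have hden : ‖(0.504 * θ * Real.log (bigP D) ^ 2 : ℂ)‖ = 0.504 * θ * (ell D ^ 9) ^ 2 := by
    have e : (0.504 * θ * Real.log (bigP D) ^ 2 : ℂ) = ((0.504 * θ * Real.log (bigP D) ^ 2 : ℝ) : ℂ) := by
      push_cast; ring
    rw [e, Complex.norm_real, Real.norm_of_nonneg (by rw [hΛ]; positivity), hΛ]
  rw [norm_div, norm_mul, norm_pow, hden]
  have hL2 : ‖deriv χ.LFunction 1‖ ^ 2 ≤ (4 * Real.exp (9 / 2) * ell D ^ 2) ^ 2 :=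
    pow_le_pow_left₀ (norm_nonneg _) hL 2
  have he : Real.exp (9 / 2) ^ 2 = Real.exp 9 := by rw [← Real.exp_nat_mul]; norm_num
  have hd0 : 0 < 0.504 * θ * (ell D ^ 9) ^ 2 := by positivity
  rw [div_le_iff₀ hd0]
  have h18 : ell D ^ 18 = (ell D ^ 9) ^ 2 := by ring
  calc ‖deriv χ.LFunction 1‖ ^ 2 * ‖ι‖ ≤ (4 * Real.exp (9 / 2) * ell D ^ 2) ^ 2 * 2.3 :=
        mul_le_mul hL2 hι (norm_nonneg _) (by positivity)
    _ = 36.8 * Real.exp 9 * ell D ^ 4 := by rw [← he]; ring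
    _ ≤ 150 * Real.exp 9 * ell D ^ 4 / ell D ^ 18 * (0.504 * θ * (ell D ^ 9) ^ 2) := by
        rw [h18]
        have hx : 0 ≤ Real.exp 9 * ell D ^ 4 := by positivity
        have : 36.8 ≤ 150 * (0.504 * θ) := by nlinarith
        have h9 : 0 < (ell D ^ 9) ^ 2 := by positivity
        calc 36.8 * Real.exp 9 * ell D ^ 4 ≤ 150 * (0.504 * θ) * (Real.exp 9 * ell D ^ 4) := by nlinarith
          _ = 150 * Real.exp 9 * ell D ^ 4 / (ell D ^ 9) ^ 2 * (0.504 * θ * (ell D ^ 9) ^ 2) := by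
              field_simp

/-- `𝔞ι/((0.504)θ log P)·X` over the prefactor of the sum: with `𝔞 = c_D L′(1,χ)²`,
`𝔞ι/((0.504)θ log P)·X = (L′²ι/((0.504)θ log²P))·c_D·log P·X`. [cite: Zhang2022LandauSiegel, §12 (12.16) p.73] -/
theorem intEx_prefactor_eq (hD2 : 2 ≤ D) (hq : χ.IsQuadratic) (hp : χ.IsPrimitive)
    (hΛ : 0 < Real.log (bigP D)) (ι : ℂ) (θ : ℝ) (hθ : 0 < θ) (X : ℂ) :
    frakA χ * ι / (0.504 * θ * Real.log (bigP D)) * X =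
      deriv χ.LFunction 1 ^ 2 * ι / (0.504 * θ * Real.log (bigP D) ^ 2) *
        ((((6 / π ^ 2 * ∏ q ∈ D.primeFactors, ((q : ℝ) / (q + 1)) : ℝ)) : ℂ) *
          ((Real.log (bigP D) : ℂ) * X)) := by
  have hΛ0 : (Real.log (bigP D) : ℂ) ≠ 0 := by exact_mod_cast hΛ.ne'
  have hθ0 : (θ : ℂ) ≠ 0 := by exact_mod_cast hθ.ne'
  rw [frakA_eq_cD_mul χ hD2 hq hp]
  field_simp

omit [NeZero D] in
/-- **One window of u049, sum → integral** (exact weight kept at level `D`): for `0.498 ≤ θ ≤ 0.5`, `μ` arbitrary and a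
continuous `g` with `‖𝓖_{jμ}(P^θ/P^z)𝓦*ˣ_j(P^z) − g(θ − z)𝓦*ˣ_j(P^z)‖ ≤ C_g𝓛⁻⁸` on `[0.496, θ]`,
`‖Σ^{win}_{P^{0.496}<n<P^θ}|χ|λ₀ⱼφ⁻¹𝓖_{jμ}(P^θ/n)𝓦*ˣ_j(n) − c_D log P ∫_{0.496}^{θ} g(θ−z)𝓦*ˣ_j(P^z)dz‖ ≤ C₀𝓛²M_tot + M +
0.004C_g𝓛`. [cite: Zhang2022LandauSiegel, §12 (12.16) p.73] -/
theorem window_sum_sub_int {C₀ : ℝ}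
    (hR : ∀ (j : ℕ) (lo hi M M' : ℝ) (G : ℝ → ℂ), 1 ≤ lo → lo ≤ hi → hi + 1 ≤ bigP D → 0 ≤ M →
      (∀ t, lo ≤ t → t ≤ hi + 1 → DifferentiableAt ℝ G t ∧ ‖G t‖ ≤ M ∧ ‖deriv G t‖ ≤ M' / t) →
      ‖lamAvg c' χ j lo hi (fun n => G n) -
          (((6 / π ^ 2 * ∏ q ∈ D.primeFactors, ((q : ℝ) / (q + 1)) : ℝ)) : ℂ) *
            ∫ t in lo..hi, G t / t‖ ≤
        C₀ * ell D ^ 2 * (M + M' * Real.log (bigP D)))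
    (hℓ6 : 6 ≤ ell D) (hc5 : 5 * |c'| * alpha D * ell D ≤ 1) (j μ : ℕ)
    {θ : ℝ} (hθ0 : 0.498 ≤ θ) (hθ1 : θ ≤ 0.5) {g : ℝ → ℂ} (hg : Continuous g) {Cg : ℝ} (hCg0 : 0 ≤ Cg)
    (hgz : ∀ z, 0.496 ≤ z → z ≤ θ →
      ‖frakgW c' D j μ (bigP D ^ θ / bigP D ^ z) * frakwStarEx c' D j (bigP D ^ z) -
          g (θ - z) * frakwStarEx c' D j (bigP D ^ z)‖ ≤ Cg * (ell D ^ 8)⁻¹) :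
    ‖winSum c' χ j (bigP D ^ (0.496 : ℝ)) (bigP D ^ θ)
          (fun n => frakgW c' D j μ (bigP D ^ θ / n) * frakwStarEx c' D j n) -
        (((6 / π ^ 2 * ∏ q ∈ D.primeFactors, ((q : ℝ) / (q + 1)) : ℝ)) : ℂ) *
          ((Real.log (bigP D) : ℂ) *
            ∫ z in (0.496 : ℝ)..θ, g (θ - z) * frakwStarEx c' D j (bigP D ^ z))‖ ≤
      C₀ * ell D ^ 2 * (146 * (1 * (1 + 7 * π)) +
          (449 * (1 * (1 + 7 * π)) + 146 * (3 * (1 + 7 * π) + 1 * 7)) * π) +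
        146 * (1 * (1 + 7 * π)) + 0.004 * Cg * ell D := by
  -- parameters
  have hℓ3 : 3 ≤ ell D := by linarith
  have hℓ1 : 1 ≤ ell D := by linarith
  have hℓ0 : 0 < ell D := by linarith
  have hℓ1' : 1 ≤ Real.log D := by rw [← ell]; exact hℓ1
  have hΛ : Real.log (bigP D) = ell D ^ 9 := by rw [bigP, Real.log_exp]
  have hΛpos : 0 < Real.log (bigP D) := by rw [hΛ]; positivity
  have hα : 0 < alpha D := Sec12D.alpha_pos_of_log hℓ1'
  have hαΛ : alpha D * Real.log (bigP D) = π := by rw [alpha, div_mul_cancel₀ _ hΛpos.ne']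
  have hP0 : 0 < bigP D := bigP_pos D
  have hP1 : 1 ≤ bigP D := one_le_bigP D
  have hP1pp1 := one_le_P1pp (D := D) hℓ3
  have hP1ppP := P1pp_le_bigP (D := D) hℓ3
  have hP1pp0 : 0 < P1pp D := by linarith
  obtain ⟨hlo1, hlolt, hlole, hlo'hi, hhiP⟩ := window_params (D := D) hℓ6 hθ0 hθ1
  set lo : ℝ := bigP D ^ (0.496 : ℝ) with hlodef
  set lo' : ℝ := ((⌊bigP D ^ (0.496 : ℝ)⌋₊ + 1 : ℕ) : ℝ) with hlo'def
  set hi : ℝ := bigP D ^ θ with hhidef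
  have hlo'1 : 1 ≤ lo' := by linarith
  have hhi1 : 1 ≤ hi := by linarith
  have hhiP' : hi ≤ bigP D := by linarith
  have hhiQ1 : 1 ≤ bigP D ^ θ := hhi1
  -- the profile (exponential form) and its bounds on `[1, P]`
  set W : ℝ := 1 + 7 * π with hW
  set M : ℝ := 146 * (1 * W) with hM
  set M' : ℝ := 449 * alpha D * (1 * W) + 146 * (3 * alpha D * W + 1 * (7 * alpha D)) with hM'
  obtain ⟨G, hGdef⟩ : ∃ G : ℝ → ℂ, G = fun u : ℝ => frakgW c' D j μ (bigP D ^ θ / u) *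
      (cexp (-(beta6 D * ((Real.log (u / P1pp D) : ℝ) : ℂ))) *
        (-1 + (beta6 D - betaJ c' D j) * (Real.log (u / P1pp D) : ℂ))) := ⟨_, rfl⟩
  have hM0 : 0 ≤ M := by rw [hM, hW]; positivity
  have hGb : ∀ t, 1 ≤ t → t ≤ bigP D → DifferentiableAt ℝ G t ∧ ‖G t‖ ≤ M ∧ ‖deriv G t‖ ≤ M' / t := by
    intro t ht1 htP
    rw [hGdef, hM, hM', hW]
    exact topG1522_bounds c' j μ hα hℓ0.le hc5 hhiQ1 hhiP' hP1pp1 hP1ppP ht1 htP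
  have hGeq : ∀ t, 0 < t → G t = frakgW c' D j μ (bigP D ^ θ / t) * frakwStarEx c' D j t := by
    intro t ht; rw [hGdef, frakwStarEx_eq_exp c' hP1pp0 j ht]
  -- (i) the window sum is `lamAvg lo' hi G`
  have hwin : winSum c' χ j lo hi (fun n => frakgW c' D j μ (bigP D ^ θ / n) * frakwStarEx c' D j n) =
      lamAvg c' χ j lo' hi (fun n => G n) := by
    rw [winSum_eq_lamAvg_floor c' χ j (by linarith) hi]
    unfold lamAvg
    refine Finset.sum_congr rfl fun n hn => ?_
    rw [Finset.mem_Ico, Nat.ceil_natCast] at hn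
    have hn0 : (0 : ℝ) < n := by exact_mod_cast (by omega : 0 < n)
    beta_reduce
    rw [hGeq n hn0]
  -- (ii) the evaluation rule on `[lo', hi]`
  have hA := hR j lo' hi M M' G hlo'1 hlo'hi hhiP hM0
    (fun t h1 h2 => hGb t (le_trans hlo'1 h1) (le_trans h2 hhiP))
  have hMM : M + M' * Real.log (bigP D) =
      146 * (1 * (1 + 7 * π)) + (449 * (1 * (1 + 7 * π)) + 146 * (3 * (1 + 7 * π) + 1 * 7)) * π := by
    rw [hM, hM', hW, ← hαΛ]; ring
  rw [hMM] at hA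
  -- (iii) the boundary piece `∫_{lo}^{lo'} G/t`
  have hGc : ContinuousOn G (Set.Icc 1 (bigP D)) := fun t ht =>
    (hGb t ht.1 ht.2).1.continuousAt.continuousWithinAt
  have hGtc : ∀ a b, 1 ≤ a → b ≤ bigP D → 1 ≤ b → a ≤ bigP D →
      IntervalIntegrable (fun t : ℝ => G t / t) MeasureTheory.volume a b := by
    intro a b ha hb hb1 haP
    refine ContinuousOn.intervalIntegrable ?_
    have hsub : Set.uIcc a b ⊆ Set.Icc 1 (bigP D) := Set.uIcc_subset_Icc ⟨ha, haP⟩ ⟨hb1, hb⟩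
    refine ContinuousOn.div (hGc.mono hsub) (Complex.continuous_ofReal.continuousOn) fun t ht => ?_
    have : (1 : ℝ) ≤ t := (hsub ht).1
    exact_mod_cast (by linarith : t ≠ 0)
  have hsplit : ∫ t in lo'..hi, G t / t = (∫ t in lo..hi, G t / t) - ∫ t in lo..lo', G t / t := by
    have h := intervalIntegral.integral_add_adjacent_intervals
      (hGtc lo lo' hlo1 (by linarith) hlo'1 (by linarith)) (hGtc lo' hi hlo'1 hhiP' hhi1 (by linarith))
    rw [← h]; ring
  have hbdry : ‖∫ t in lo..lo', G t / t‖ ≤ M := by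
    have hpt : ∀ t ∈ Set.uIoc lo lo', ‖G t / t‖ ≤ M := by
      intro t ht
      rw [Set.uIoc_of_le hlolt.le, Set.mem_Ioc] at ht
      have ht1 : 1 ≤ t := by linarith
      have htP : t ≤ bigP D := by linarith
      rw [norm_div, Complex.norm_real, Real.norm_of_nonneg (by linarith)]
      calc ‖G t‖ / t ≤ M / 1 := div_le_div₀ hM0 (hGb t ht1 htP).2.1 one_pos ht1
        _ = M := div_one _
    have h := intervalIntegral.norm_integral_le_of_norm_le_const hpt
    have habs : |lo' - lo| ≤ 1 := by rw [abs_of_pos (by linarith)]; linarith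
    calc ‖∫ t in lo..lo', G t / t‖ ≤ M * |lo' - lo| := h
      _ ≤ M * 1 := by gcongr
      _ = M := mul_one _
  -- (iv) the substitution `t = P^z` on `[lo, hi]`
  obtain ⟨Λ, hΛdef⟩ : ∃ Λ : ℝ, Λ = Real.log (bigP D) := ⟨_, rfl⟩
  have hsub : ∫ t in lo..hi, G t / t = (Λ : ℂ) * ∫ z in (0.496 : ℝ)..θ, G (bigP D ^ z) := by
    rw [hlodef, hhidef, bigP_rpow_eq_Ppow D 0.496, bigP_rpow_eq_Ppow D θ, ← hΛdef,
      integral_Ppow_Ppow (by rw [hΛdef]; exact hΛpos.le)]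
    congr 1
    refine intervalIntegral.integral_congr fun z _ => ?_
    simp only [bigP_rpow_eq_Ppow D z, ← hΛdef]
  -- (v) the comparison at `P^z`
  obtain ⟨Iz, hIz⟩ : ∃ Iz : ℝ → ℂ, Iz = fun z => g (θ - z) * frakwStarEx c' D j (bigP D ^ z) := ⟨_, rfl⟩
  have hpt : ∀ z ∈ Set.uIoc (0.496 : ℝ) θ, ‖G (bigP D ^ z) - Iz z‖ ≤ Cg * (ell D ^ 8)⁻¹ := by
    intro z hz
    rw [Set.uIoc_of_le (by linarith), Set.mem_Ioc] at hz
    rw [hGeq _ (Real.rpow_pos_of_pos hP0 z), hIz]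
    exact hgz z hz.1.le hz.2
  have hGzc : ContinuousOn (fun z : ℝ => G (bigP D ^ z)) (Set.uIcc (0.496 : ℝ) θ) := by
    intro z hz
    rw [Set.uIcc_of_le (by linarith)] at hz
    have hz1 : 1 ≤ bigP D ^ z := Real.one_le_rpow hP1 (by linarith [hz.1])
    have hzP : bigP D ^ z ≤ bigP D := by
      calc bigP D ^ z ≤ bigP D ^ (1 : ℝ) := Real.rpow_le_rpow_of_exponent_le hP1 (by linarith [hz.2])
        _ = bigP D := Real.rpow_one _
    exact ((hGb _ hz1 hzP).1.continuousAt.comp (Real.continuousAt_const_rpow hP0.ne')).continuousWithinAt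
  have hIc : Continuous Iz := by
    rw [hIz]
    have hw : Continuous fun z : ℝ => frakwStarEx c' D j (bigP D ^ z) :=
      Sec12D.continuous_wStarEx_rpow c' hℓ1 j
    exact (hg.comp (by fun_prop)).mul hw
  have hdiff : ‖(∫ z in (0.496 : ℝ)..θ, G (bigP D ^ z)) - ∫ z in (0.496 : ℝ)..θ, Iz z‖ ≤
      Cg * (ell D ^ 8)⁻¹ * 0.004 := by
    rw [← intervalIntegral.integral_sub (hGzc.intervalIntegrable) (hIc.intervalIntegrable _ _)]
    have h := intervalIntegral.norm_integral_le_of_norm_le_const hpt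
    have habs : |θ - 0.496| ≤ 0.004 := by rw [abs_of_nonneg (by linarith)]; linarith
    calc ‖∫ z in (0.496 : ℝ)..θ, G (bigP D ^ z) - Iz z‖ ≤ Cg * (ell D ^ 8)⁻¹ * |θ - 0.496| := h
      _ ≤ Cg * (ell D ^ 8)⁻¹ * 0.004 := by gcongr
  -- assemble
  obtain ⟨cD, hcD⟩ : ∃ cD : ℝ, cD = 6 / π ^ 2 * ∏ q ∈ D.primeFactors, ((q : ℝ) / (q + 1)) := ⟨_, rfl⟩
  obtain ⟨hcD0, hcD1⟩ : 0 ≤ cD ∧ cD ≤ 1 := by rw [hcD]; exact RangeAverage.frakcD_bounds D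
  rw [← hcD] at hA ⊢
  rw [hwin, ← hΛdef, ← hIz]
  have key : lamAvg c' χ j lo' hi (fun n => G n) - (cD : ℂ) * ((Λ : ℂ) * ∫ z in (0.496 : ℝ)..θ, Iz z) =
      (lamAvg c' χ j lo' hi (fun n => G n) - (cD : ℂ) * ∫ t in lo'..hi, G t / t) -
        (cD : ℂ) * (∫ t in lo..lo', G t / t) +
        (cD : ℂ) * (Λ : ℂ) * ((∫ z in (0.496 : ℝ)..θ, G (bigP D ^ z)) - ∫ z in (0.496 : ℝ)..θ, Iz z) := by
    rw [hsplit, hsub]; ring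
  rw [key]
  have hΛ9 : Λ = ell D ^ 9 := by rw [hΛdef, hΛ]
  have n2 : ‖(cD : ℂ) * (∫ t in lo..lo', G t / t)‖ ≤ 146 * (1 * (1 + 7 * π)) := by
    rw [norm_mul, Complex.norm_real, Real.norm_of_nonneg hcD0]
    calc cD * ‖∫ t in lo..lo', G t / t‖ ≤ 1 * M := mul_le_mul hcD1 hbdry (norm_nonneg _) zero_le_one
      _ = 146 * (1 * (1 + 7 * π)) := by rw [hM, hW]; ring
  have n3 : ‖(cD : ℂ) * (Λ : ℂ) * ((∫ z in (0.496 : ℝ)..θ, G (bigP D ^ z)) - ∫ z in (0.496 : ℝ)..θ, Iz z)‖ ≤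
      0.004 * Cg * ell D := by
    rw [norm_mul, norm_mul, Complex.norm_real, Complex.norm_real, Real.norm_of_nonneg hcD0, hΛ9,
      Real.norm_of_nonneg (by positivity)]
    have h8 : 0 < ell D ^ 8 := by positivity
    calc cD * ell D ^ 9 * ‖(∫ z in (0.496 : ℝ)..θ, G (bigP D ^ z)) - ∫ z in (0.496 : ℝ)..θ, Iz z‖
        ≤ 1 * ell D ^ 9 * (Cg * (ell D ^ 8)⁻¹ * 0.004) :=
          mul_le_mul (mul_le_mul_of_nonneg_right hcD1 (by positivity)) hdiff (norm_nonneg _) (by positivity)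
      _ = 0.004 * Cg * ell D := by field_simp
  calc ‖(lamAvg c' χ j lo' hi (fun n => G n) - (cD : ℂ) * ∫ t in lo'..hi, G t / t) -
          (cD : ℂ) * (∫ t in lo..lo', G t / t) +
        (cD : ℂ) * (Λ : ℂ) * ((∫ z in (0.496 : ℝ)..θ, G (bigP D ^ z)) - ∫ z in (0.496 : ℝ)..θ, Iz z)‖
      ≤ ‖lamAvg c' χ j lo' hi (fun n => G n) - (cD : ℂ) * ∫ t in lo'..hi, G t / t‖ +
          ‖(cD : ℂ) * (∫ t in lo..lo', G t / t)‖ +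
        ‖(cD : ℂ) * (Λ : ℂ) * ((∫ z in (0.496 : ℝ)..θ, G (bigP D ^ z)) - ∫ z in (0.496 : ℝ)..θ, Iz z)‖ := by
        refine (norm_add_le _ _).trans ?_
        gcongr
        exact norm_sub_le _ _
    _ ≤ _ := add_le_add (add_le_add hA n2) n3

set_option maxHeartbeats 400000 in
/-- **`Z22:§12.u049`, second line, EXACT reading, holds** [Z22 p.73, tex L3694–L3702]: for every `c′`, all large `D`
(real primitive `χ` mod `D`) and `j = 1, 2, 3`, `‖main12u049sumEx − main12u049intEx‖ ≤ εα` — the window sums with the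
weight `𝓖_{jμ}(P^θ/n)𝓦*ˣ_j(n)` equal the printed `z`-integrals with `𝔤𝔥_{jμ}(θ − z)𝓦*ˣ_j(P^z)` within `o(α)` (indeed
`≪_{c′} 𝓛⁻¹²`). PROVED OUTRIGHT (no manuscript claim as hypothesis). [cite: Zhang2022LandauSiegel, §12 (12.16) p.73] -/
theorem main12u049sumEx_sub_intEx :
    ∀ ε : ℝ, 0 < ε → ForAllLarge fun D _ χ => ∀ j ∈ ({1, 2, 3} : Finset ℕ),
      ‖main12u049sumEx c' χ j - main12u049intEx c' χ j‖ ≤ ε * alpha D := by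
  intro ε hε
  obtain ⟨C₀, hC₀, hrule⟩ := lamAvg_rule c'
  -- the constants
  obtain ⟨Cp, hCp⟩ : ∃ Cp : ℝ, Cp = 75 * |c'| * π ^ 2 + 40 * |c'| ^ 2 * π ^ 3 := ⟨_, rfl⟩
  obtain ⟨Mtot, hMtot⟩ : ∃ Mtot : ℝ, Mtot = 146 * (1 * (1 + 7 * π)) +
      (449 * (1 * (1 + 7 * π)) + 146 * (3 * (1 + 7 * π) + 1 * 7)) * π := ⟨_, rfl⟩
  obtain ⟨B, hB⟩ : ∃ B : ℝ, B = 146 * (1 * (1 + 7 * π)) + 0.004 * (Cp * (1 + 7 * π)) := ⟨_, rfl⟩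
  obtain ⟨Ctot, hCtot⟩ : ∃ Ctot : ℝ, Ctot = 300 * Real.exp 9 * (C₀ * Mtot + B) := ⟨_, rfl⟩
  have hCp0 : 0 ≤ Cp := by rw [hCp]; positivity
  have hMtot0 : 0 ≤ Mtot := by rw [hMtot]; positivity
  have hB0 : 0 ≤ B := by rw [hB]; positivity
  have hCtot0 : 0 ≤ Ctot := by rw [hCtot]; positivity
  have hbig : ForAllLarge fun D _ _ => Ctot / (ε * π) + 1 ≤ ell D := by
    refine ⟨⌈Real.exp (Ctot / (ε * π) + 1)⌉₊, fun D _ χ hD _ _ => ?_⟩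
    have hexp : Real.exp (Ctot / (ε * π) + 1) ≤ D := le_trans (Nat.le_ceil _) (by exact_mod_cast hD)
    show Ctot / (ε * π) + 1 ≤ Real.log D
    exact (Real.le_log_iff_exp_le (lt_of_lt_of_le (Real.exp_pos _) hexp)).mpr hexp
  refine ((hrule.and (forAllLarge_five_c c')).and hbig).mono ?_
  intro D _ χ hq hp ⟨⟨hR, hD3, hℓ6, hc5⟩, hℓbig⟩ j hj
  -- parameters
  have hD2 : 2 ≤ D := by omega
  have hℓ3 : 3 ≤ ell D := by linarith
  have hℓ1 : 1 ≤ ell D := by linarith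
  have hℓ0 : 0 < ell D := by linarith
  have hℓ1' : 1 ≤ Real.log D := by rw [← ell]; exact hℓ1
  have hΛ : Real.log (bigP D) = ell D ^ 9 := by rw [bigP, Real.log_exp]
  have hΛpos : 0 < Real.log (bigP D) := by rw [hΛ]; positivity
  have hα : 0 < alpha D := Sec12D.alpha_pos_of_log hℓ1'
  have hαeq : alpha D = π / ell D ^ 9 := by rw [alpha, hΛ]
  obtain ⟨hι3, hι4⟩ := norm_iota34_le
  -- the two windows
  have hW6 := window_sum_sub_int c' χ hR hℓ6 hc5 j 6 (θ := 0.498) (by norm_num) (by norm_num)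
    (g := ghj j 6) ?_ (Cg := Cp * (1 + 7 * π)) (by positivity) ?_
  rotate_left
  · simp only [Finset.mem_insert, Finset.mem_singleton] at hj
    rcases hj with rfl | rfl | rfl
    · exact continuous_ghF (8/3) (-5/3) (-1/2) (3/2)
    · exact continuous_ghF (4/3) (-1/3) (1/2) (3/2)
    · exact continuous_ghF (8/9) (1/9) (1/6) (3/2)
  · intro z hz0 hz1
    have hw := norm_frakwStarEx_rpow_le c' j hℓ3 hc5 (z := z) (by linarith) (by linarith)
    refine (frakgW_six_at_rpow c' hD3 hj (by linarith) (by linarith) _).trans ?_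
    rw [hCp]
    calc (75 * |c'| * π ^ 2 + 40 * |c'| ^ 2 * π ^ 3) * (ell D ^ 8)⁻¹ * ‖frakwStarEx c' D j (bigP D ^ z)‖
        ≤ (75 * |c'| * π ^ 2 + 40 * |c'| ^ 2 * π ^ 3) * (ell D ^ 8)⁻¹ * (1 + 7 * π) :=
          mul_le_mul_of_nonneg_left hw (by positivity)
      _ = (75 * |c'| * π ^ 2 + 40 * |c'| ^ 2 * π ^ 3) * (1 + 7 * π) * (ell D ^ 8)⁻¹ := by ring
  have hW7 := window_sum_sub_int c' χ hR hℓ6 hc5 j 7 (θ := 0.5) (by norm_num) (by norm_num)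
    (g := ghj j 7) ?_ (Cg := Cp * (1 + 7 * π)) (by positivity) ?_
  rotate_left
  · simp only [Finset.mem_insert, Finset.mem_singleton] at hj
    rcases hj with rfl | rfl | rfl
    · exact continuous_ghF (24/25) (1/25) (1/10) (5/2)
    · exact continuous_ghF (12/25) (13/25) (3/10) (5/2)
    · exact continuous_ghF (8/25) (17/25) (-3/10) (5/2)
  · intro z hz0 hz1
    have hw := norm_frakwStarEx_rpow_le c' j hℓ3 hc5 (z := z) (by linarith) (by linarith)
    refine (frakgW_seven_at_rpow c' hD3 hj (by linarith) (by linarith) _).trans ?_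
    rw [hCp]
    calc (75 * |c'| * π ^ 2 + 40 * |c'| ^ 2 * π ^ 3) * (ell D ^ 8)⁻¹ * ‖frakwStarEx c' D j (bigP D ^ z)‖
        ≤ (75 * |c'| * π ^ 2 + 40 * |c'| ^ 2 * π ^ 3) * (ell D ^ 8)⁻¹ * (1 + 7 * π) :=
          mul_le_mul_of_nonneg_left hw (by positivity)
      _ = (75 * |c'| * π ^ 2 + 40 * |c'| ^ 2 * π ^ 3) * (1 + 7 * π) * (ell D ^ 8)⁻¹ := by ring
  -- prefactors
  set K6 : ℂ := deriv χ.LFunction 1 ^ 2 * iota3 / (0.504 * 0.498 * Real.log (bigP D) ^ 2) with hK6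
  set K7 : ℂ := deriv χ.LFunction 1 ^ 2 * iota4 / (0.504 * 0.5 * Real.log (bigP D) ^ 2) with hK7
  have hK6n : ‖K6‖ ≤ 150 * Real.exp 9 * ell D ^ 4 / ell D ^ 18 := by
    have h := norm_K1522_le χ hℓ3 hp (ι := iota3) (by linarith) (θ := 0.498) (by norm_num)
    have e : ((0.498 : ℝ) : ℂ) = (0.498 : ℂ) := by norm_num
    rw [e] at h
    simpa only [hK6] using h
  have hK7n : ‖K7‖ ≤ 150 * Real.exp 9 * ell D ^ 4 / ell D ^ 18 := by
    have h := norm_K1522_le χ hℓ3 hp (ι := iota4) hι4 (θ := 0.5) (by norm_num)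
    have e : ((0.5 : ℝ) : ℂ) = (0.5 : ℂ) := by norm_num
    rw [e] at h
    simpa only [hK7] using h
  set cD : ℝ := 6 / π ^ 2 * ∏ q ∈ D.primeFactors, ((q : ℝ) / (q + 1)) with hcD
  set S6 := winSum c' χ j (bigP D ^ (0.496 : ℝ)) (bigP D ^ (0.498 : ℝ))
    (fun n => frakgW c' D j 6 (bigP D ^ (0.498 : ℝ) / n) * frakwStarEx c' D j n) with hS6
  set S7 := winSum c' χ j (bigP D ^ (0.496 : ℝ)) (bigP D ^ (0.5 : ℝ))
    (fun n => frakgW c' D j 7 (bigP D ^ (0.5 : ℝ) / n) * frakwStarEx c' D j n) with hS7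
  set I6 := ∫ z in (0.496 : ℝ)..0.498, ghj j 6 (0.498 - z) * frakwStarEx c' D j (bigP D ^ z) with hI6
  set I7 := ∫ z in (0.496 : ℝ)..0.5, ghj j 7 (0.5 - z) * frakwStarEx c' D j (bigP D ^ z) with hI7
  -- `sum = K6 S6 + K7 S7`, `int = K6 cD Λ I6 + K7 cD Λ I7`
  have hsum : main12u049sumEx c' χ j = K6 * S6 + K7 * S7 := by
    simp only [main12u049sumEx, hK6, hK7, hS6, hS7]
  have hint : main12u049intEx c' χ j =
      K6 * ((cD : ℂ) * ((Real.log (bigP D) : ℂ) * I6)) + K7 * ((cD : ℂ) * ((Real.log (bigP D) : ℂ) * I7)) := by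
    simp only [main12u049intEx, hK6, hK7, hI6, hI7, hcD]
    have e6 := intEx_prefactor_eq χ hD2 hq hp hΛpos iota3 0.498 (by norm_num)
      (∫ z in (0.496 : ℝ)..0.498, ghj j 6 (0.498 - z) * frakwStarEx c' D j (bigP D ^ z))
    have e7 := intEx_prefactor_eq χ hD2 hq hp hΛpos iota4 0.5 (by norm_num)
      (∫ z in (0.496 : ℝ)..0.5, ghj j 7 (0.5 - z) * frakwStarEx c' D j (bigP D ^ z))
    have c1 : (0.504 * 0.498 * (Real.log (bigP D) : ℂ)) = (0.504 * ((0.498 : ℝ) : ℂ) * (Real.log (bigP D) : ℂ)) := by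
      push_cast; ring
    have c2 : (0.504 * 0.5 * (Real.log (bigP D) : ℂ)) = (0.504 * ((0.5 : ℝ) : ℂ) * (Real.log (bigP D) : ℂ)) := by
      push_cast; ring
    have c3 : (0.504 * 0.498 * (Real.log (bigP D) : ℂ) ^ 2) =
        (0.504 * ((0.498 : ℝ) : ℂ) * (Real.log (bigP D) : ℂ) ^ 2) := by push_cast; ring
    have c4 : (0.504 * 0.5 * (Real.log (bigP D) : ℂ) ^ 2) =
        (0.504 * ((0.5 : ℝ) : ℂ) * (Real.log (bigP D) : ℂ) ^ 2) := by push_cast; ring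
    rw [c1, c2, c3, c4, e6, e7]
  rw [hsum, hint]
  have key : K6 * S6 + K7 * S7 -
      (K6 * ((cD : ℂ) * ((Real.log (bigP D) : ℂ) * I6)) + K7 * ((cD : ℂ) * ((Real.log (bigP D) : ℂ) * I7))) =
      K6 * (S6 - (cD : ℂ) * ((Real.log (bigP D) : ℂ) * I6)) + K7 * (S7 - (cD : ℂ) * ((Real.log (bigP D) : ℂ) * I7)) := by
    ring
  rw [key]
  set E : ℝ := C₀ * ell D ^ 2 * Mtot + B * ell D with hE
  have hE6 : ‖S6 - (cD : ℂ) * ((Real.log (bigP D) : ℂ) * I6)‖ ≤ E := by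
    refine hW6.trans ?_
    rw [hE, hMtot, hB]
    have h0 : 0 ≤ 146 * (1 * (1 + 7 * π)) := by positivity
    have : 146 * (1 * (1 + 7 * π)) ≤ 146 * (1 * (1 + 7 * π)) * ell D := by nlinarith
    have hx : 0.004 * (Cp * (1 + 7 * π)) * ell D ≤ 0.004 * (Cp * (1 + 7 * π)) * ell D := le_rfl
    linarith
  have hE7 : ‖S7 - (cD : ℂ) * ((Real.log (bigP D) : ℂ) * I7)‖ ≤ E := by
    refine hW7.trans ?_
    rw [hE, hMtot, hB]
    have h0 : 0 ≤ 146 * (1 * (1 + 7 * π)) := by positivity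
    have : 146 * (1 * (1 + 7 * π)) ≤ 146 * (1 * (1 + 7 * π)) * ell D := by nlinarith
    have hx : 0.004 * (Cp * (1 + 7 * π)) * ell D ≤ 0.004 * (Cp * (1 + 7 * π)) * ell D := le_rfl
    linarith
  have hE0 : 0 ≤ E := (norm_nonneg _).trans hE6
  have htot : ‖K6 * (S6 - (cD : ℂ) * ((Real.log (bigP D) : ℂ) * I6)) +
        K7 * (S7 - (cD : ℂ) * ((Real.log (bigP D) : ℂ) * I7))‖ ≤ (‖K6‖ + ‖K7‖) * E := by
    calc ‖K6 * (S6 - (cD : ℂ) * ((Real.log (bigP D) : ℂ) * I6)) +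
          K7 * (S7 - (cD : ℂ) * ((Real.log (bigP D) : ℂ) * I7))‖
        ≤ ‖K6‖ * ‖S6 - (cD : ℂ) * ((Real.log (bigP D) : ℂ) * I6)‖ +
            ‖K7‖ * ‖S7 - (cD : ℂ) * ((Real.log (bigP D) : ℂ) * I7)‖ := by
          refine (norm_add_le _ _).trans ?_; rw [norm_mul, norm_mul]
      _ ≤ ‖K6‖ * E + ‖K7‖ * E := by gcongr
      _ = (‖K6‖ + ‖K7‖) * E := by ring
  have hKsum : ‖K6‖ + ‖K7‖ ≤ 300 * Real.exp 9 * ell D ^ 4 / ell D ^ 18 := by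
    have e : (150 : ℝ) * Real.exp 9 * ell D ^ 4 / ell D ^ 18 + 150 * Real.exp 9 * ell D ^ 4 / ell D ^ 18 =
        300 * Real.exp 9 * ell D ^ 4 / ell D ^ 18 := by ring
    have := add_le_add hK6n hK7n; linarith
  rw [hCtot] at hℓbig
  have hfin := arith_final (nK := ‖K6‖ + ‖K7‖) (nS := E) hℓ1 hε (by positivity) hC₀ hMtot0 hB0 hE0 hKsum
    (le_of_eq hE) hℓbig
  rw [hαeq]
  exact htot.trans hfin

end Top1522Int

end Literature.NumberTheory.LFunctions.Zhang2022.Typed.Sec12C
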